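import Summits.QuantumFields.YangMills.Theorems.BalabanUVNodesN21NormaliseMeasurableDefs
import Summits.QuantumFields.YangMills.Theorems.BalabanUVNodesN21RStepMarginalsBgIL

/-!
# N21 (NE7c), strategy s3 «alternative currency», file 37 — AT THE MEASURABLY NORMALISED FAMILY OF RECORD `𝔟ᴺᴹ`: KT-28's (LOC) and the mixture road's
# ℝ-step identities ((0.4) per summand, post-ℝ weight = pre-ℝ weight, the (N)∕(Eoff) marginal identity) with (LOC), (DISJ) AND (H-U) ALL THEOREMS —
# binders left: the telescope provisos, the numerics, the `Z`-geometry of the OFF cubes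

HEADER — WORK-UNIT METADATA.  Seat `pub-ymgap-dag-n21-e` (R141 (C) fan-out, node N21 = NE7c `T4IndicatorShell.ShellWeightBound`, strategy s3), g11, file 37;
the one-application file of 34b (`𝔟ᴺᴹ := bgNormMFamOfRecord F N ν`, carrying (H-L) `interiorLocalBg_bgNormMFam` and (H-U) `localBgMeasurableBg_bgNormMFam` as
THEOREMS) at 35 (`…N21InteriorLocalBg`) and 36 (`…N21RStepMarginalsBgIL`).  Lane: `--kind proof --supports stmt-QuantumFields-20544 --as helper` (K3⁷
`SpineGivenEndpointR13SepCoPH`).  Count-neutral.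

THE CONTENT (file 32's statements with `normalise (bgFamOfRecord …) _ ↦ bgNormMFamOfRecord F N ν K k` and the binder `hU` GONE):
§1 ★★ `fibreIndep_chiSeqNM_off_of_far` ∕ `fibreIndep_chiSeqNM_off_of_far_fibOfSeq` — KT-28's (LOC) at `𝔟ᴺᴹ` MODULO NUMERICS ONLY (35 (A3) ∕ (A5)).
§2 ★ `integral_rstepSummand_eq_bgNM` · ★ `rstepWeight_eq_bgNM` — (0.4) per summand ∕ per threshold vector at `u := statᴺᴹ` (36 §2).
§3 ★★ `map_rstepSummand_eq_bgNM` · ★★ `map_rstepSummand_eq_bgNM_fibOfSeq` — the (N)∕(Eoff) marginal identity at `u := statᴺᴹ` (36 §3).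
§4 (28 (N4) at `𝔟ᴺᴹ`) `chiSlotNM_eq_chiSlot_of_solvable_of_huniq` · `chiSlotNM_le_chiSlot_of_huniq` · ★ `chiSeqNM_le_chiSeqOfRecord_of_huniq` — the identification with the
   record's RAW χ: equal on solvable cubes under plaquette-uniqueness `huniq` (DISPLAYED; [15] Thm 1's consequence), dominated everywhere (`χᴺᴹ ≤ χ`).
§5 (K0c's row (P3) generic in the family) `measurable_chiSeqOfRecordBg_of_localBg` · ★ `measurable_chiSeqNM` — `χᴺᴹ_k(Ω_k)` is measurable, NO hypothesis.
Binders left, all DISPLAYED: `TermProvisos fib f″ f C` (the telescope's provisos on the factor-free parts), the numerics `0 < k ≤ m + K`, `1 ≤ M₁`, `1 ≤ M₂`,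
`L·M₁ ≤ L^{k+1}M₂R_k`, and the geometry `□^{≈7} ∩ Z = ∅` on the cube family `A` (which cubes are OFF; the ON-set is counted by file 33).

HONEST FRAMING.  NE7c is NOT PRINTED and NOT PROVED.  [folklore] bookkeeping: seven applications.  `𝔟ᴺᴹ` is an OFFERED twin of the family of record (same class,
same solvable domain, a (2.12) minimiser wherever the record's map is one); the identification of its χ with the record's RAW χ stays one-sided under `huniq` exactly as
for `𝔟ᴺ` (28 (N4)); no record is restated or re-pointed; N21 NOT discharged; counts UNMOVED (typed 28∕28 · discharged 5∕27); count-neutral; one finite 𝕋⁴ at fixed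
`ε`; NOT ℝ⁴ ∕ OS ∕ mass gap ∕ Clay.  No `sorry`, no `axiom`, no `instance`, no `notation`.

CITATION HEADER (lean-in-tree rule 2026-08-18).  BY NAME: 34b `bgNormMFamOfRecord` ∕ `interiorLocalBg_bgNormMFam` ∕ `localBgMeasurableBg_bgNormMFam`; 13a
`chiSmall_eq_smallInd_iSup`; n20-d `N20ChiSemantics.chiSmall_ukBox_eq_one_of_not_solvable` ∕ `isMinimizer_ukBox_of_solvable`; FILE 19 `chiSeqOfRecordBg_apply` ∕
`chiSeqOfRecordBg_bgFam`; FILE 4 `chiSeqOfRecord`; `T4AxialGaugeFixing.measurable_chiSmall`; `B14.Eq218Concrete.chiSmall` ∕ `chiSmall_nonneg` ∕ `chiSmall_le_one`; 35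
`fibreIndep_chiSeqBg_off_of_far` ∕ `fibreIndep_chiSeqBg_off_of_far_fibOfSeq`; 36 `integral_rstepSummand_eq_bgIL` ∕ `rstepWeight_eq_bgIL` ∕ `map_rstepSummand_eq_bgIL` ∕
`map_rstepSummand_eq_bgIL_fibOfSeq`; def-R `Node00.cubeEnl` ∕ `cubeSide` ∕ `cubeIndices` ∕ `RkOfRecord` ∕ `plaqInside` ∕ `bondsMeeting` ∕ `fibOfSeq` ∕ `zpOfSeq` ∕
`SeqOfRecord` ∕ `Stage7Numerics` ∕ `TowerNumerics`; `B14.Eq218Concrete.Seq` ∕ `cubesIn`; b01 `B15.BasicStep.normTerm`; `T4ObservableTelescope.TermProvisos`; `T4DressedR.FibreIndep`;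
`T4IndicatorShell.smallInd`; `T4LipschitzLedger.Pol`; `Setup.fieldMeasure`; r11 `B14.Eq216Concrete.ukBox`.  Context only (SHAPE, nothing asserted): [Balaban1989LargeFieldI]
(0.3)–(0.4) p. 176, (1.1) p. 177; [Balaban1988Convergent] (2.16)–(2.18) p. 257.
-/

set_option autoImplicit false

noncomputable section

open MeasureTheory Set
open scoped BigOperators ENNReal

namespace Summit.QuantumFields.YangMills.Theorems.N21RStepMarginalsBgNM

open Literature.MathematicalPhysics.QuantumFieldTheory.Balaban1983to89
open Literature.MathematicalPhysics.QuantumFieldTheory.Balaban1983to89.Node00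
open T4Continuum B15DeterminingSets B14.Eq213DetSet B14.Eq216Concrete B14.Eq12InteriorLocality B14.Eq213MaximalDomains B15Eq112TorusCover
  B14DomainGeom B14.Eq218Concrete
open Literature.MathematicalPhysics.QuantumFieldTheory.Balaban1983to89.B15.BasicStep (normTerm)
open Literature.MathematicalPhysics.QuantumFieldTheory.Balaban1983to89.T4DressedR (FibreIndep)
open Literature.MathematicalPhysics.QuantumFieldTheory.Balaban1983to89.T4ObservableTelescope (TermProvisos)
open Literature.MathematicalPhysics.QuantumFieldTheory.Balaban1983to89.T4IndicatorShell (smallInd)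
open Literature.MathematicalPhysics.QuantumFieldTheory.Balaban1983to89.T4LipschitzLedger (Pol)
open Summit.QuantumFields.YangMills.Theorems.N21NormaliseMeasurableDefs (bgNormMFamOfRecord interiorLocalBg_bgNormMFam localBgMeasurableBg_bgNormMFam)
open Summit.QuantumFields.YangMills.Theorems.N21InteriorLocalBg (fibreIndep_chiSeqBg_off_of_far fibreIndep_chiSeqBg_off_of_far_fibOfSeq)
open Summit.QuantumFields.YangMills.Theorems.N21RStepMarginalsBgIL (integral_rstepSummand_eq_bgIL rstepWeight_eq_bgIL map_rstepSummand_eq_bgIL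
  map_rstepSummand_eq_bgIL_fibOfSeq)
open Summit.QuantumFields.YangMills.Theorems.N21ThresholdMixtureRecordChi (chiSmall_eq_smallInd_iSup)
open Summit.QuantumFields.YangMills.BalabanUVNodes.N20ChiSemantics (chiSmall_ukBox_eq_one_of_not_solvable isMinimizer_ukBox_of_solvable)
open Literature.MathematicalPhysics.QuantumFieldTheory.BalabanImbrieJaffe1984to88.BIJ85Eq453GaugeField (qsstarGIter0)

variable (F : T4Family) (N : ℕ) [NeZero N]

/-! ## §1 KT-28's (LOC) at `𝔟ᴺᴹ` modulo numerics only -/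

/-- ★★ **KT-28's (LOC) AT `𝔟ᴺᴹ` MODULO NUMERICS ONLY** (35 (A3) at the measurably normalised family of record): for every fibre `fib ⊆ bondsMeeting k Z`, polarity and
threshold vector, the product of χ-slots over the cubes of `Ω_k(s)` outside a set `On` containing every cube whose `□^{≈7}` meets `Z` is fibre-independent of `fib`
(binders: `0 < k ≤ m + K`, `1 ≤ M₁`, `1 ≤ M₂`, `L·M₁ ≤ L^{k+1}M₂R_k`). [cite: Balaban1988Convergent, (2.16)–(2.18) p.257; Balaban1989LargeFieldI, (0.3) p.176, (1.1) p.177] -/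
theorem fibreIndep_chiSeqNM_off_of_far (ν : Stage7Numerics) (g : ℕ → ℝ) (K k : ℕ) [DecidableEq (PBond (F.P K) k)]
    (hk : k ≤ (F.P K).m + (F.P K).K) (hk0 : 0 < k) (hM : 1 ≤ ν.M₁) (hM₂ : 1 ≤ ν.M₂)
    (hnum : (F.P K).L * ν.M₁ ≤ cubeSide (F.P K).L ν.M₂ (RkOfRecord (F.P K).L ν.r (g k)) k)
    (Z : Set (Site (F.P K) 0)) (fib : Finset (PBond (F.P K) k)) (hfib : ∀ b ∈ fib, b ∈ bondsMeeting k Z)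
    {D : ℕ → Set (Set (Site (F.P K) 0))} (s : Seq D k)
    (On : Finset ↥(cubeIndices (F.P K) (cubeSide (F.P K).L ν.M₂ (RkOfRecord (F.P K).L ν.r (g k)) k)))
    (hOn : ∀ c : ↥(cubeIndices (F.P K) (cubeSide (F.P K).L ν.M₂ (RkOfRecord (F.P K).L ν.r (g k)) k)), c ∉ On →
      ∀ z ∈ Z, z ∉ cubeEnl (F.P K) (cubeSide (F.P K).L ν.M₂ (RkOfRecord (F.P K).L ν.r (g k)) k) c 7)
    (pol : ↥(cubeIndices (F.P K) (cubeSide (F.P K).L ν.M₂ (RkOfRecord (F.P K).L ν.r (g k)) k)) → Pol)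
    (S : ↥(cubeIndices (F.P K) (cubeSide (F.P K).L ν.M₂ (RkOfRecord (F.P K).L ν.r (g k)) k)) → ℝ) :
    FibreIndep fib fun V : GaugeField (F.P K) k (SU N) =>
      ∏ c ∈ (cubesIn (fun a : ↥(cubeIndices (F.P K) (cubeSide (F.P K).L ν.M₂ (RkOfRecord (F.P K).L ν.r (g k)) k)) =>
          cubeEnl (F.P K) (cubeSide (F.P K).L ν.M₂ (RkOfRecord (F.P K).L ν.r (g k)) k) a 0) (s.Ω k)).filter (fun c => c ∉ On),
        (pol c).fac (smallInd (⨆ p : ↥(plaqInside (cubeEnl (F.P K) (cubeSide (F.P K).L ν.M₂ (RkOfRecord (F.P K).L ν.r (g k)) k) c 1)),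
          dist1 (GaugeField.plaqHol (ukBox (bgNormMFamOfRecord F N ν K k) ν.M₁
            (cubeEnl (F.P K) (cubeSide (F.P K).L ν.M₂ (RkOfRecord (F.P K).L ν.r (g k)) k) c 4) k V) p.1)) (S c)) :=
  fibreIndep_chiSeqBg_off_of_far F N ν (interiorLocalBg_bgNormMFam F N ν) g K k hk hk0 hM hM₂ hnum Z fib hfib s On hOn pol S

/-- ★★ **… AT def-R's FIBRE** (`fib := fibOfSeq F ν τ p g k sq`, `Z := Z′(sq) = zpOfSeq …`). [cite: Balaban1988Convergent, (2.16)–(2.18) p.257; Balaban1989LargeFieldI, (0.3) p.176, (1.1) p.177] -/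
theorem fibreIndep_chiSeqNM_off_of_far_fibOfSeq (ν : Stage7Numerics) (τ : TowerNumerics) (p : B12.RunParams) (g : ℕ → ℝ) (k : ℕ)
    [DecidableEq (PBond (F.P p.K) k)]
    (hk : k ≤ (F.P p.K).m + (F.P p.K).K) (hk0 : 0 < k) (hM : 1 ≤ ν.M₁) (hM₂ : 1 ≤ ν.M₂)
    (hnum : (F.P p.K).L * ν.M₁ ≤ cubeSide (F.P p.K).L ν.M₂ (RkOfRecord (F.P p.K).L ν.r (g k)) k)
    (sq : SeqOfRecord F ν τ.M g p.K k) {D : ℕ → Set (Set (Site (F.P p.K) 0))} (s : Seq D k)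
    (On : Finset ↥(cubeIndices (F.P p.K) (cubeSide (F.P p.K).L ν.M₂ (RkOfRecord (F.P p.K).L ν.r (g k)) k)))
    (hOn : ∀ c : ↥(cubeIndices (F.P p.K) (cubeSide (F.P p.K).L ν.M₂ (RkOfRecord (F.P p.K).L ν.r (g k)) k)), c ∉ On →
      ∀ z ∈ zpOfSeq F ν τ g p.K k sq, z ∉ cubeEnl (F.P p.K) (cubeSide (F.P p.K).L ν.M₂ (RkOfRecord (F.P p.K).L ν.r (g k)) k) c 7)
    (pol : ↥(cubeIndices (F.P p.K) (cubeSide (F.P p.K).L ν.M₂ (RkOfRecord (F.P p.K).L ν.r (g k)) k)) → Pol)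
    (S : ↥(cubeIndices (F.P p.K) (cubeSide (F.P p.K).L ν.M₂ (RkOfRecord (F.P p.K).L ν.r (g k)) k)) → ℝ) :
    FibreIndep (fibOfSeq F ν τ p g k sq) fun V : GaugeField (F.P p.K) k (SU N) =>
      ∏ c ∈ (cubesIn (fun a : ↥(cubeIndices (F.P p.K) (cubeSide (F.P p.K).L ν.M₂ (RkOfRecord (F.P p.K).L ν.r (g k)) k)) =>
          cubeEnl (F.P p.K) (cubeSide (F.P p.K).L ν.M₂ (RkOfRecord (F.P p.K).L ν.r (g k)) k) a 0) (s.Ω k)).filter (fun c => c ∉ On),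
        (pol c).fac (smallInd (⨆ q : ↥(plaqInside (cubeEnl (F.P p.K) (cubeSide (F.P p.K).L ν.M₂ (RkOfRecord (F.P p.K).L ν.r (g k)) k) c 1)),
          dist1 (GaugeField.plaqHol (ukBox (bgNormMFamOfRecord F N ν p.K k) ν.M₁
            (cubeEnl (F.P p.K) (cubeSide (F.P p.K).L ν.M₂ (RkOfRecord (F.P p.K).L ν.r (g k)) k) c 4) k V) q.1)) (S c)) :=
  fibreIndep_chiSeqBg_off_of_far_fibOfSeq F N ν (interiorLocalBg_bgNormMFam F N ν) τ p g k hk hk0 hM hM₂ hnum sq s On hOn pol S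

/-! ## §2 (0.4) per summand ∕ per threshold vector at `u := statᴺᴹ` — NO (H-U) binder -/

/-- ★ **(0.4) PER SUMMAND AT `𝔟ᴺᴹ`, (LOC) + (DISJ) + (H-U) ALL THEOREMS** (36 `integral_rstepSummand_eq_bgIL` at the measurably normalised family of record): for a
fibre `fib ⊆ bondsMeeting k Z`, cube families `A″ ⊆ A` with every `□ ∈ A` far from `Z`, polarities agreeing on `A″`, provisos on the factor-free parts, the post-ℝ
summand has the sender's sharp mass at every threshold vector `S`.  Binders: `0 < k ≤ m + K`, `1 ≤ M₁`, `1 ≤ M₂`, `L·M₁ ≤ L^{k+1}M₂R_k`.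
[cite: Balaban1989LargeFieldI, (0.4) p.176; Balaban1988Convergent, (2.16)–(2.18) p.257] -/
theorem integral_rstepSummand_eq_bgNM (ν : Stage7Numerics) (g : ℕ → ℝ) (K k : ℕ) [DecidableEq (PBond (F.P K) k)]
    (hk : k ≤ (F.P K).m + (F.P K).K) (hk0 : 0 < k) (hM : 1 ≤ ν.M₁) (hM₂ : 1 ≤ ν.M₂)
    (hnum : (F.P K).L * ν.M₁ ≤ cubeSide (F.P K).L ν.M₂ (RkOfRecord (F.P K).L ν.r (g k)) k)
    (Z : Set (Site (F.P K) 0)) (fib : Finset (PBond (F.P K) k)) (hfib : ∀ b ∈ fib, b ∈ bondsMeeting k Z)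
    {A A'' : Finset ↥(cubeIndices (F.P K) (cubeSide (F.P K).L ν.M₂ (RkOfRecord (F.P K).L ν.r (g k)) k))} (hsub : A'' ⊆ A)
    (hA : ∀ c ∈ A, ∀ z ∈ Z, z ∉ cubeEnl (F.P K) (cubeSide (F.P K).L ν.M₂ (RkOfRecord (F.P K).L ν.r (g k)) k) c 7)
    (pol pol'' : ↥(cubeIndices (F.P K) (cubeSide (F.P K).L ν.M₂ (RkOfRecord (F.P K).L ν.r (g k)) k)) → Pol) (hpol : ∀ c ∈ A'', pol'' c = pol c)
    {f f'' : Density (F.P K) k (SU N)} {C : ℝ} (hP : TermProvisos fib f'' f C)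
    (S : ↥(cubeIndices (F.P K) (cubeSide (F.P K).L ν.M₂ (RkOfRecord (F.P K).L ν.r (g k)) k)) → ℝ) :
    ∫ V, normTerm fib
        (fun U => (∏ c ∈ A'', (pol'' c).fac (smallInd
          (⨆ p : ↥(plaqInside (cubeEnl (F.P K) (cubeSide (F.P K).L ν.M₂ (RkOfRecord (F.P K).L ν.r (g k)) k) c 1)),
            dist1 (GaugeField.plaqHol (ukBox (bgNormMFamOfRecord F N ν K k) ν.M₁
              (cubeEnl (F.P K) (cubeSide (F.P K).L ν.M₂ (RkOfRecord (F.P K).L ν.r (g k)) k) c 4) k U) p.1)) (S c))) * f'' U)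
        (fun U => (∏ c ∈ A, (pol c).fac (smallInd
          (⨆ p : ↥(plaqInside (cubeEnl (F.P K) (cubeSide (F.P K).L ν.M₂ (RkOfRecord (F.P K).L ν.r (g k)) k) c 1)),
            dist1 (GaugeField.plaqHol (ukBox (bgNormMFamOfRecord F N ν K k) ν.M₁
              (cubeEnl (F.P K) (cubeSide (F.P K).L ν.M₂ (RkOfRecord (F.P K).L ν.r (g k)) k) c 4) k U) p.1)) (S c))) * f U) V
        ∂fieldMeasure (F.P K) k (SU N)
      = ∫ V, (∏ c ∈ A, (pol c).fac (smallInd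
          (⨆ p : ↥(plaqInside (cubeEnl (F.P K) (cubeSide (F.P K).L ν.M₂ (RkOfRecord (F.P K).L ν.r (g k)) k) c 1)),
            dist1 (GaugeField.plaqHol (ukBox (bgNormMFamOfRecord F N ν K k) ν.M₁
              (cubeEnl (F.P K) (cubeSide (F.P K).L ν.M₂ (RkOfRecord (F.P K).L ν.r (g k)) k) c 4) k V) p.1)) (S c))) * f V
        ∂fieldMeasure (F.P K) k (SU N) :=
  integral_rstepSummand_eq_bgIL F N ν (interiorLocalBg_bgNormMFam F N ν) (localBgMeasurableBg_bgNormMFam F N ν) g K k hk hk0 hM hM₂ hnum Z fib hfib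
    hsub hA pol pol'' hpol hP S

/-- ★ **POST-ℝ WEIGHT = PRE-ℝ WEIGHT AT EVERY THRESHOLD VECTOR, AT `𝔟ᴺᴹ`, NO (H-U) BINDER** (36 `rstepWeight_eq_bgIL`).
[cite: Balaban1989LargeFieldI, (0.4) p.176; Balaban1988Convergent, (2.17)–(2.18) p.257] -/
theorem rstepWeight_eq_bgNM {Θ : Type*} (ν : Stage7Numerics) (g : ℕ → ℝ) (K k : ℕ) [DecidableEq (PBond (F.P K) k)]
    (hk : k ≤ (F.P K).m + (F.P K).K) (hk0 : 0 < k) (hM : 1 ≤ ν.M₁) (hM₂ : 1 ≤ ν.M₂)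
    (hnum : (F.P K).L * ν.M₁ ≤ cubeSide (F.P K).L ν.M₂ (RkOfRecord (F.P K).L ν.r (g k)) k)
    (Z : Set (Site (F.P K) 0)) (fib : Finset (PBond (F.P K) k)) (hfib : ∀ b ∈ fib, b ∈ bondsMeeting k Z)
    {A A'' : Finset ↥(cubeIndices (F.P K) (cubeSide (F.P K).L ν.M₂ (RkOfRecord (F.P K).L ν.r (g k)) k))} (hsub : A'' ⊆ A)
    (hA : ∀ c ∈ A, ∀ z ∈ Z, z ∉ cubeEnl (F.P K) (cubeSide (F.P K).L ν.M₂ (RkOfRecord (F.P K).L ν.r (g k)) k) c 7)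
    (pol pol'' : ↥(cubeIndices (F.P K) (cubeSide (F.P K).L ν.M₂ (RkOfRecord (F.P K).L ν.r (g k)) k)) → Pol) (hpol : ∀ c ∈ A'', pol'' c = pol c)
    (fS f''S : Θ → Density (F.P K) k (SU N)) {C : ℝ} (hP : ∀ S, TermProvisos fib (f''S S) (fS S) C)
    (thr : Θ → ↥(cubeIndices (F.P K) (cubeSide (F.P K).L ν.M₂ (RkOfRecord (F.P K).L ν.r (g k)) k)) → ℝ) (S : Θ) :
    ∫ V, normTerm fib
        (fun U => (∏ c ∈ A'', (pol'' c).fac (smallInd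
          (⨆ p : ↥(plaqInside (cubeEnl (F.P K) (cubeSide (F.P K).L ν.M₂ (RkOfRecord (F.P K).L ν.r (g k)) k) c 1)),
            dist1 (GaugeField.plaqHol (ukBox (bgNormMFamOfRecord F N ν K k) ν.M₁
              (cubeEnl (F.P K) (cubeSide (F.P K).L ν.M₂ (RkOfRecord (F.P K).L ν.r (g k)) k) c 4) k U) p.1)) (thr S c))) * f''S S U)
        (fun U => (∏ c ∈ A, (pol c).fac (smallInd
          (⨆ p : ↥(plaqInside (cubeEnl (F.P K) (cubeSide (F.P K).L ν.M₂ (RkOfRecord (F.P K).L ν.r (g k)) k) c 1)),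
            dist1 (GaugeField.plaqHol (ukBox (bgNormMFamOfRecord F N ν K k) ν.M₁
              (cubeEnl (F.P K) (cubeSide (F.P K).L ν.M₂ (RkOfRecord (F.P K).L ν.r (g k)) k) c 4) k U) p.1)) (thr S c))) * fS S U) V
        ∂fieldMeasure (F.P K) k (SU N)
      = ∫ V, (∏ c ∈ A, (pol c).fac (smallInd
          (⨆ p : ↥(plaqInside (cubeEnl (F.P K) (cubeSide (F.P K).L ν.M₂ (RkOfRecord (F.P K).L ν.r (g k)) k) c 1)),
            dist1 (GaugeField.plaqHol (ukBox (bgNormMFamOfRecord F N ν K k) ν.M₁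
              (cubeEnl (F.P K) (cubeSide (F.P K).L ν.M₂ (RkOfRecord (F.P K).L ν.r (g k)) k) c 4) k V) p.1)) (thr S c))) * fS S V
        ∂fieldMeasure (F.P K) k (SU N) :=
  rstepWeight_eq_bgIL F N ν (interiorLocalBg_bgNormMFam F N ν) (localBgMeasurableBg_bgNormMFam F N ν) g K k hk hk0 hM hM₂ hnum Z fib hfib hsub hA pol pol''
    hpol fS f''S hP thr S

/-! ## §3 The (N)∕(Eoff) marginal identity at `u := statᴺᴹ` — NO (H-U) binder -/

/-- ★★ **THE (N)∕(Eoff) BINDER OF THE RESAMPLING TOWER AT THE CURRENT FIELD, AT `𝔟ᴺᴹ`, (LOC) + (DISJ) + (H-U) ALL THEOREMS** (36 `map_rstepSummand_eq_bgIL`): for a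
fibre `fib ⊆ bondsMeeting k Z`, cube families `A″ ⊆ A` far from `Z`, agreeing polarities on `A″`, provisos, and every measurable fibre-independent statistic `w`, the
`w`-marginal of the post-ℝ summand's law equals the `w`-marginal of the sender's law.  Binders: `0 < k ≤ m + K`, `1 ≤ M₁`, `1 ≤ M₂`, `L·M₁ ≤ L^{k+1}M₂R_k`.
[cite: Balaban1989LargeFieldI, (0.3)–(0.4) p.176; Balaban1988Convergent, (2.16)–(2.18) p.257] -/
theorem map_rstepSummand_eq_bgNM (ν : Stage7Numerics) (g : ℕ → ℝ) (K k : ℕ) [DecidableEq (PBond (F.P K) k)]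
    (hk : k ≤ (F.P K).m + (F.P K).K) (hk0 : 0 < k) (hM : 1 ≤ ν.M₁) (hM₂ : 1 ≤ ν.M₂)
    (hnum : (F.P K).L * ν.M₁ ≤ cubeSide (F.P K).L ν.M₂ (RkOfRecord (F.P K).L ν.r (g k)) k)
    (Z : Set (Site (F.P K) 0)) (fib : Finset (PBond (F.P K) k)) (hfib : ∀ b ∈ fib, b ∈ bondsMeeting k Z)
    {A A'' : Finset ↥(cubeIndices (F.P K) (cubeSide (F.P K).L ν.M₂ (RkOfRecord (F.P K).L ν.r (g k)) k))} (hsub : A'' ⊆ A)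
    (hA : ∀ c ∈ A, ∀ z ∈ Z, z ∉ cubeEnl (F.P K) (cubeSide (F.P K).L ν.M₂ (RkOfRecord (F.P K).L ν.r (g k)) k) c 7)
    (pol pol'' : ↥(cubeIndices (F.P K) (cubeSide (F.P K).L ν.M₂ (RkOfRecord (F.P K).L ν.r (g k)) k)) → Pol) (hpol : ∀ c ∈ A'', pol'' c = pol c)
    {f f'' : Density (F.P K) k (SU N)} {C : ℝ} (hP : TermProvisos fib f'' f C)
    (S : ↥(cubeIndices (F.P K) (cubeSide (F.P K).L ν.M₂ (RkOfRecord (F.P K).L ν.r (g k)) k)) → ℝ)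
    {w : GaugeField (F.P K) k (SU N) → ℝ} (hwm : Measurable w) (hw : FibreIndep fib w) :
    ((fieldMeasure (F.P K) k (SU N)).withDensity fun V => ENNReal.ofReal (normTerm fib
        (fun U => (∏ c ∈ A'', (pol'' c).fac (smallInd
          (⨆ p : ↥(plaqInside (cubeEnl (F.P K) (cubeSide (F.P K).L ν.M₂ (RkOfRecord (F.P K).L ν.r (g k)) k) c 1)),
            dist1 (GaugeField.plaqHol (ukBox (bgNormMFamOfRecord F N ν K k) ν.M₁
              (cubeEnl (F.P K) (cubeSide (F.P K).L ν.M₂ (RkOfRecord (F.P K).L ν.r (g k)) k) c 4) k U) p.1)) (S c))) * f'' U)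
        (fun U => (∏ c ∈ A, (pol c).fac (smallInd
          (⨆ p : ↥(plaqInside (cubeEnl (F.P K) (cubeSide (F.P K).L ν.M₂ (RkOfRecord (F.P K).L ν.r (g k)) k) c 1)),
            dist1 (GaugeField.plaqHol (ukBox (bgNormMFamOfRecord F N ν K k) ν.M₁
              (cubeEnl (F.P K) (cubeSide (F.P K).L ν.M₂ (RkOfRecord (F.P K).L ν.r (g k)) k) c 4) k U) p.1)) (S c))) * f U) V)).map w
      = ((fieldMeasure (F.P K) k (SU N)).withDensity fun V => ENNReal.ofReal ((∏ c ∈ A, (pol c).fac (smallInd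
          (⨆ p : ↥(plaqInside (cubeEnl (F.P K) (cubeSide (F.P K).L ν.M₂ (RkOfRecord (F.P K).L ν.r (g k)) k) c 1)),
            dist1 (GaugeField.plaqHol (ukBox (bgNormMFamOfRecord F N ν K k) ν.M₁
              (cubeEnl (F.P K) (cubeSide (F.P K).L ν.M₂ (RkOfRecord (F.P K).L ν.r (g k)) k) c 4) k V) p.1)) (S c))) * f V)).map w :=
  map_rstepSummand_eq_bgIL F N ν (interiorLocalBg_bgNormMFam F N ν) (localBgMeasurableBg_bgNormMFam F N ν) g K k hk hk0 hM hM₂ hnum Z fib hfib hsub hA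
    pol pol'' hpol hP S hwm hw

/-- ★★ **ONE APPLICATION AT def-R's FIBRE, AT `𝔟ᴺᴹ`** (`fib := fibOfSeq F ν τ p g k sq`, `Z := Z′(sq) = zpOfSeq …`; 36 `map_rstepSummand_eq_bgIL_fibOfSeq`).
[cite: Balaban1989LargeFieldI, (0.3)–(0.4) p.176, (1.1) p.177; Balaban1988Convergent, (2.16)–(2.18) p.257] -/
theorem map_rstepSummand_eq_bgNM_fibOfSeq (ν : Stage7Numerics) (τ : TowerNumerics) (p : B12.RunParams) (g : ℕ → ℝ) (k : ℕ)
    [DecidableEq (PBond (F.P p.K) k)]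
    (hk : k ≤ (F.P p.K).m + (F.P p.K).K) (hk0 : 0 < k) (hM : 1 ≤ ν.M₁) (hM₂ : 1 ≤ ν.M₂)
    (hnum : (F.P p.K).L * ν.M₁ ≤ cubeSide (F.P p.K).L ν.M₂ (RkOfRecord (F.P p.K).L ν.r (g k)) k)
    (sq : SeqOfRecord F ν τ.M g p.K k)
    {A A'' : Finset ↥(cubeIndices (F.P p.K) (cubeSide (F.P p.K).L ν.M₂ (RkOfRecord (F.P p.K).L ν.r (g k)) k))} (hsub : A'' ⊆ A)
    (hA : ∀ c ∈ A, ∀ z ∈ zpOfSeq F ν τ g p.K k sq, z ∉ cubeEnl (F.P p.K) (cubeSide (F.P p.K).L ν.M₂ (RkOfRecord (F.P p.K).L ν.r (g k)) k) c 7)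
    (pol pol'' : ↥(cubeIndices (F.P p.K) (cubeSide (F.P p.K).L ν.M₂ (RkOfRecord (F.P p.K).L ν.r (g k)) k)) → Pol) (hpol : ∀ c ∈ A'', pol'' c = pol c)
    {f f'' : Density (F.P p.K) k (SU N)} {C : ℝ} (hP : TermProvisos (fibOfSeq F ν τ p g k sq) f'' f C)
    (S : ↥(cubeIndices (F.P p.K) (cubeSide (F.P p.K).L ν.M₂ (RkOfRecord (F.P p.K).L ν.r (g k)) k)) → ℝ)
    {w : GaugeField (F.P p.K) k (SU N) → ℝ} (hwm : Measurable w) (hw : FibreIndep (fibOfSeq F ν τ p g k sq) w) :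
    ((fieldMeasure (F.P p.K) k (SU N)).withDensity fun V => ENNReal.ofReal (normTerm (fibOfSeq F ν τ p g k sq)
        (fun U => (∏ c ∈ A'', (pol'' c).fac (smallInd
          (⨆ q : ↥(plaqInside (cubeEnl (F.P p.K) (cubeSide (F.P p.K).L ν.M₂ (RkOfRecord (F.P p.K).L ν.r (g k)) k) c 1)),
            dist1 (GaugeField.plaqHol (ukBox (bgNormMFamOfRecord F N ν p.K k) ν.M₁
              (cubeEnl (F.P p.K) (cubeSide (F.P p.K).L ν.M₂ (RkOfRecord (F.P p.K).L ν.r (g k)) k) c 4) k U) q.1)) (S c))) * f'' U)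
        (fun U => (∏ c ∈ A, (pol c).fac (smallInd
          (⨆ q : ↥(plaqInside (cubeEnl (F.P p.K) (cubeSide (F.P p.K).L ν.M₂ (RkOfRecord (F.P p.K).L ν.r (g k)) k) c 1)),
            dist1 (GaugeField.plaqHol (ukBox (bgNormMFamOfRecord F N ν p.K k) ν.M₁
              (cubeEnl (F.P p.K) (cubeSide (F.P p.K).L ν.M₂ (RkOfRecord (F.P p.K).L ν.r (g k)) k) c 4) k U) q.1)) (S c))) * f U) V)).map w
      = ((fieldMeasure (F.P p.K) k (SU N)).withDensity fun V => ENNReal.ofReal ((∏ c ∈ A, (pol c).fac (smallInd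
          (⨆ q : ↥(plaqInside (cubeEnl (F.P p.K) (cubeSide (F.P p.K).L ν.M₂ (RkOfRecord (F.P p.K).L ν.r (g k)) k) c 1)),
            dist1 (GaugeField.plaqHol (ukBox (bgNormMFamOfRecord F N ν p.K k) ν.M₁
              (cubeEnl (F.P p.K) (cubeSide (F.P p.K).L ν.M₂ (RkOfRecord (F.P p.K).L ν.r (g k)) k) c 4) k V) q.1)) (S c))) * f V)).map w :=
  map_rstepSummand_eq_bgIL_fibOfSeq F N ν (interiorLocalBg_bgNormMFam F N ν) (localBgMeasurableBg_bgNormMFam F N ν) τ p g k hk hk0 hM hM₂ hnum sq hsub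
    hA pol pol'' hpol hP S hwm hw

/-! ## §4 The identification with the record's RAW χ at `𝔟ᴺᴹ` (28 (N4) verbatim): equal on solvable cubes under plaquette-uniqueness, dominated everywhere -/

/-- (N4-a) On a cube whose (2.16) datum is SOLVABLE, under plaquette-uniqueness on its tested plaquettes, the χ-slot at `𝔟ᴺᴹ` EQUALS the record's raw χ-slot
(both backgrounds are (2.12) minimisers for the same datum: `𝔟ᴺᴹ` is a solution map of the same spec). [cite: Balaban1988Convergent, (2.12) p.256, (2.16)–(2.17) p.257] -/
theorem chiSlotNM_eq_chiSlot_of_solvable_of_huniq (ν : Stage7Numerics) (g : ℕ → ℝ) (K k : ℕ)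
    (a : ↥(cubeIndices (F.P K) (cubeSide (F.P K).L ν.M₂ (RkOfRecord (F.P K).L ν.r (g k)) k))) {V : GaugeField (F.P K) k (SU N)}
    (hsol : ∃ U₀, IsMinimizer (avOfRecord F N K) {U | PlaqSmall (ν.εreg * (F.P K).eta k ^ 2) U}
      (Bj ν.M₁ (cubeEnl (F.P K) (cubeSide (F.P K).L ν.M₂ (RkOfRecord (F.P K).L ν.r (g k)) k) a 4) k) (avgFamily (avOfRecord F N K) (qsstarGIter0 k V)) U₀)
    (huniq : ∀ (X : MSField (F.P K) (SU N)) (U₀ U₁ : GaugeField (F.P K) 0 (SU N)),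
      IsMinimizer (avOfRecord F N K) {U | PlaqSmall (ν.εreg * (F.P K).eta k ^ 2) U}
        (Bj ν.M₁ (cubeEnl (F.P K) (cubeSide (F.P K).L ν.M₂ (RkOfRecord (F.P K).L ν.r (g k)) k) a 4) k) X U₀ →
      IsMinimizer (avOfRecord F N K) {U | PlaqSmall (ν.εreg * (F.P K).eta k ^ 2) U}
        (Bj ν.M₁ (cubeEnl (F.P K) (cubeSide (F.P K).L ν.M₂ (RkOfRecord (F.P K).L ν.r (g k)) k) a 4) k) X U₁ →
      ∀ p ∈ plaqInside (cubeEnl (F.P K) (cubeSide (F.P K).L ν.M₂ (RkOfRecord (F.P K).L ν.r (g k)) k) a 1),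
        dist1 (GaugeField.plaqHol U₀ p) = dist1 (GaugeField.plaqHol U₁ p))
    {θ : ℝ} (hθ : 0 < θ) :
    chiSmall (plaqInside (cubeEnl (F.P K) (cubeSide (F.P K).L ν.M₂ (RkOfRecord (F.P K).L ν.r (g k)) k) a 1)) θ
        (ukBox (bgNormMFamOfRecord F N ν K k) ν.M₁ (cubeEnl (F.P K) (cubeSide (F.P K).L ν.M₂ (RkOfRecord (F.P K).L ν.r (g k)) k) a 4) k V)
      = chiSmall (plaqInside (cubeEnl (F.P K) (cubeSide (F.P K).L ν.M₂ (RkOfRecord (F.P K).L ν.r (g k)) k) a 1)) θ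
        (ukBox (bgFamOfRecord F N ν K k) ν.M₁ (cubeEnl (F.P K) (cubeSide (F.P K).L ν.M₂ (RkOfRecord (F.P K).L ν.r (g k)) k) a 4) k V) := by
  rw [chiSmall_eq_smallInd_iSup (Or.inr hθ), chiSmall_eq_smallInd_iSup (Or.inr hθ)]
  refine congrArg (smallInd · θ) (iSup_congr fun p => ?_)
  exact huniq _ _ _
    ((bgNormMFamOfRecord F N ν K k).isMinimizer
      (Bj ν.M₁ (cubeEnl (F.P K) (cubeSide (F.P K).L ν.M₂ (RkOfRecord (F.P K).L ν.r (g k)) k) a 4) k) _ hsol)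
    (isMinimizer_ukBox_of_solvable hsol) p.1 p.2

/-- (N4-b) **THE χ-SLOT AT `𝔟ᴺᴹ` IS DOMINATED BY THE RECORD's RAW χ-SLOT** under plaquette-uniqueness: equal on a solvable cube (N4-a), and on an unsolvable cube
the record's slot is junk-`1` (n20-d `chiSmall_ukBox_eq_one_of_not_solvable`). [cite: Balaban1988Convergent, (2.12) p.256, (2.17) p.257 (typing convention)] -/
theorem chiSlotNM_le_chiSlot_of_huniq (ν : Stage7Numerics) (g : ℕ → ℝ) (K k : ℕ)
    (a : ↥(cubeIndices (F.P K) (cubeSide (F.P K).L ν.M₂ (RkOfRecord (F.P K).L ν.r (g k)) k))) (V : GaugeField (F.P K) k (SU N))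
    (huniq : ∀ (X : MSField (F.P K) (SU N)) (U₀ U₁ : GaugeField (F.P K) 0 (SU N)),
      IsMinimizer (avOfRecord F N K) {U | PlaqSmall (ν.εreg * (F.P K).eta k ^ 2) U}
        (Bj ν.M₁ (cubeEnl (F.P K) (cubeSide (F.P K).L ν.M₂ (RkOfRecord (F.P K).L ν.r (g k)) k) a 4) k) X U₀ →
      IsMinimizer (avOfRecord F N K) {U | PlaqSmall (ν.εreg * (F.P K).eta k ^ 2) U}
        (Bj ν.M₁ (cubeEnl (F.P K) (cubeSide (F.P K).L ν.M₂ (RkOfRecord (F.P K).L ν.r (g k)) k) a 4) k) X U₁ →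
      ∀ p ∈ plaqInside (cubeEnl (F.P K) (cubeSide (F.P K).L ν.M₂ (RkOfRecord (F.P K).L ν.r (g k)) k) a 1),
        dist1 (GaugeField.plaqHol U₀ p) = dist1 (GaugeField.plaqHol U₁ p))
    {θ : ℝ} (hθ : 0 < θ) :
    chiSmall (plaqInside (cubeEnl (F.P K) (cubeSide (F.P K).L ν.M₂ (RkOfRecord (F.P K).L ν.r (g k)) k) a 1)) θ
        (ukBox (bgNormMFamOfRecord F N ν K k) ν.M₁ (cubeEnl (F.P K) (cubeSide (F.P K).L ν.M₂ (RkOfRecord (F.P K).L ν.r (g k)) k) a 4) k V)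
      ≤ chiSmall (plaqInside (cubeEnl (F.P K) (cubeSide (F.P K).L ν.M₂ (RkOfRecord (F.P K).L ν.r (g k)) k) a 1)) θ
        (ukBox (bgFamOfRecord F N ν K k) ν.M₁ (cubeEnl (F.P K) (cubeSide (F.P K).L ν.M₂ (RkOfRecord (F.P K).L ν.r (g k)) k) a 4) k V) := by
  by_cases hsol : ∃ U₀, IsMinimizer (avOfRecord F N K) {U | PlaqSmall (ν.εreg * (F.P K).eta k ^ 2) U}
      (Bj ν.M₁ (cubeEnl (F.P K) (cubeSide (F.P K).L ν.M₂ (RkOfRecord (F.P K).L ν.r (g k)) k) a 4) k) (avgFamily (avOfRecord F N K) (qsstarGIter0 k V)) U₀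
  · exact (chiSlotNM_eq_chiSlot_of_solvable_of_huniq F N ν g K k a hsol huniq hθ).le
  · have h1 : chiSmall (plaqInside (cubeEnl (F.P K) (cubeSide (F.P K).L ν.M₂ (RkOfRecord (F.P K).L ν.r (g k)) k) a 1)) θ
        (ukBox (bgFamOfRecord F N ν K k) ν.M₁ (cubeEnl (F.P K) (cubeSide (F.P K).L ν.M₂ (RkOfRecord (F.P K).L ν.r (g k)) k) a 4) k V) = 1 :=
      chiSmall_ukBox_eq_one_of_not_solvable _ hθ hsol
    rw [h1]
    exact chiSmall_le_one _ _ _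

/-- ★ (N4-c) **`χᴺᴹ_k(Ω_k) ≤ χ_k(Ω_k)` OF RECORD, pointwise, under plaquette-uniqueness on every cube of `Ω_k(s)`** — FILE 19's sequence χ over `𝔟ᴺᴹ` is dominated
by FILE 4's `chiSeqOfRecord` (factors in `[0, 1]`); equality where every cube of `Ω_k(s)` is solvable. [cite: Balaban1988Convergent, (2.12) p.256, (2.17)–(2.18) p.257 (typing convention)] -/
theorem chiSeqNM_le_chiSeqOfRecord_of_huniq (ν : Stage7Numerics) (M : ℕ) (g : ℕ → ℝ) (K k : ℕ)
    (hε : 0 < epsOfRecord ν g k * (F.P K).eta k ^ 2) (s : SeqOfRecord F ν M g K k) (V : GaugeField (F.P K) k (SU N))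
    (huniq : ∀ (a : ↥(cubeIndices (F.P K) (cubeSide (F.P K).L ν.M₂ (RkOfRecord (F.P K).L ν.r (g k)) k))) (X : MSField (F.P K) (SU N))
      (U₀ U₁ : GaugeField (F.P K) 0 (SU N)),
      IsMinimizer (avOfRecord F N K) {U | PlaqSmall (ν.εreg * (F.P K).eta k ^ 2) U}
        (Bj ν.M₁ (cubeEnl (F.P K) (cubeSide (F.P K).L ν.M₂ (RkOfRecord (F.P K).L ν.r (g k)) k) a 4) k) X U₀ →
      IsMinimizer (avOfRecord F N K) {U | PlaqSmall (ν.εreg * (F.P K).eta k ^ 2) U}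
        (Bj ν.M₁ (cubeEnl (F.P K) (cubeSide (F.P K).L ν.M₂ (RkOfRecord (F.P K).L ν.r (g k)) k) a 4) k) X U₁ →
      ∀ p ∈ plaqInside (cubeEnl (F.P K) (cubeSide (F.P K).L ν.M₂ (RkOfRecord (F.P K).L ν.r (g k)) k) a 1),
        dist1 (GaugeField.plaqHol U₀ p) = dist1 (GaugeField.plaqHol U₁ p)) :
    chiSeqOfRecordBg F N (bgNormMFamOfRecord F N ν) ν M g K k s V ≤ chiSeqOfRecord F N ν M g K k s V := by
  rw [← chiSeqOfRecordBg_bgFam, chiSeqOfRecordBg_apply, chiSeqOfRecordBg_apply]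
  exact Finset.prod_le_prod (fun a _ => chiSmall_nonneg _ _ _) fun a _ => chiSlotNM_le_chiSlot_of_huniq F N ν g K k a V (huniq a) hε

/-! ## §5 (P3)-shape at a datum family: `χ_k(Ω_k)` over any (H-U) family is measurable; at `𝔟ᴺᴹ` hypothesis-free -/

/-- K0c's row-(P3) face GENERIC IN THE DATUM FAMILY: under (H-U) `LocalBgMeasurableBg F N ν 𝔟`, FILE 19's `χ_k(Ω_k)` over `𝔟` is measurable at every level and
sequence (`chiSeqOfRecordBg_apply` + `T4AxialGaugeFixing.measurable_chiSmall`). [cite: Balaban1988Convergent, (2.17)–(2.18) p.257 (bookkeeping)] -/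
theorem measurable_chiSeqOfRecordBg_of_localBg {𝔟 : BgFam F N} (ν : Stage7Numerics) (hU : LocalBgMeasurableBg F N ν 𝔟) (M : ℕ) (g : ℕ → ℝ) (K k : ℕ)
    (s : SeqOfRecord F ν M g K k) : Measurable (chiSeqOfRecordBg F N 𝔟 ν M g K k s) := by
  have h : chiSeqOfRecordBg F N 𝔟 ν M g K k s = fun V =>
      ∏ a ∈ cubesIn (fun a : ↥(cubeIndices (F.P K) (cubeSide (F.P K).L ν.M₂ (RkOfRecord (F.P K).L ν.r (g k)) k)) =>
          cubeEnl (F.P K) (cubeSide (F.P K).L ν.M₂ (RkOfRecord (F.P K).L ν.r (g k)) k) a 0) (s.Ω k),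
        chiSmall (plaqInside (cubeEnl (F.P K) (cubeSide (F.P K).L ν.M₂ (RkOfRecord (F.P K).L ν.r (g k)) k) a 1))
          (epsOfRecord ν g k * (F.P K).eta k ^ 2)
          (ukBox (𝔟 K k) ν.M₁ (cubeEnl (F.P K) (cubeSide (F.P K).L ν.M₂ (RkOfRecord (F.P K).L ν.r (g k)) k) a 4) k V) :=
    funext fun V => chiSeqOfRecordBg_apply F N 𝔟 ν M g K k s V
  rw [h]
  exact Finset.measurable_prod _ fun a _ => (T4AxialGaugeFixing.measurable_chiSmall _ _).comp (hU K k _)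

/-- ★ **`χᴺᴹ_k(Ω_k)` IS MEASURABLE — NO HYPOTHESIS** (row (P3) at the measurably normalised family of record). [cite: Balaban1988Convergent, (2.17)–(2.18) p.257 (bookkeeping)] -/
theorem measurable_chiSeqNM (ν : Stage7Numerics) (M : ℕ) (g : ℕ → ℝ) (K k : ℕ) (s : SeqOfRecord F ν M g K k) :
    Measurable (chiSeqOfRecordBg F N (bgNormMFamOfRecord F N ν) ν M g K k s) :=
  measurable_chiSeqOfRecordBg_of_localBg F N ν (localBgMeasurableBg_bgNormMFam F N ν) M g K k s

end Summit.QuantumFields.YangMills.Theorems.N21RStepMarginalsBgNM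

end
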